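import Summits.QuantumFields.BalabanUV.T4Continuum.Support.NE9LinSizeEndCPiece
import Summits.QuantumFields.BalabanUV.T4Continuum.Support.NE9ComplexEncoding

/-!
# NE9DoubledChart — the CUBE CHART and the cluster geometry ON THE Re/Im-DOUBLED CARRIERS, and the d-currency END face of row NE9
# for a class-relative piece form on the doubled carriers AT THE DOUBLED CHART OF AN ORDINARY CUBE CHART (cell `pub-balaban`,
# T4-DAG §2 node U3 / §6 NE9; rung (B)+1 on a FIXED finite T⁴; NE9 formalisation crew, unit `b2b-balaban-t4-ne9-formalise-leaf-07`
# gen 5, own-initiative lineage item «DBL-CHART» — LOCATED FINDING F-ne9leaf07g5-1 below; nothing of any import modified, no END re-wired)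

HONEST FRAMING (T4-DAG PAGE 1).  Rung (B)+1 = existence and uniqueness of the ε → 0 limit of gauge-invariant observables on a
FIXED finite torus T⁴ — NOT infinite volume, NOT a mass gap, NOT the Clay problem.  NE9 is a cell NEW ESTIMATE, NOT PRINTED and
NOT discharged here («NE9 ⇐ the named binders»).  [I]/[II] locators below are TYPE locators (ABSOLUTE RULE: nothing printed in the
audited series is asserted); `FlowStep.BetaPertH`, (B), (B^μ) do not occur.  HONEST DEPENDENCY (verbatim): continuum YM on T⁴ ⇐
BetaPertH ∧ nine spine estimates (0/9 proved); BetaPertH ⇐ (D1) ∧ (D4) ∧ CAP+tail; G-an2-4 gates asym, D1 and NE2/3/4.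

LOCATED FINDING F-ne9leaf07g5-1 (this seat, on its own lineage's faces).  The complex-domain typing of the species (skeleton
v1.3 TYPING NOTE; `NE9ComplexEncoding.doubleCarriers`, p209236) puts every FORM-level species of the (1.23)-pieces — the owner's
`RemData.toC` (ray sub-case) and `CurData.toC` (gen 25) alike, both `CPieceData (doubleCarriers C) …` — on the DOUBLED carriers
`C.Dom × Bool`.  Consequently every d-currency END face at a species (this lineage's E5′-REM p213078 / E5′-REM-ADD p213266, leaf-01's
budgets p213373 / p213554) quantifies over a cube chart `Γ : CubeChart (doubleCarriers C) (Fin ν → ZMod N) (torusAdj ν N) D`, and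
every t-currency END face at a species (owner part 3 p213009, MP-REM p213217, A3-REM-END p213409, …) over a cluster geometry
`G : ClusterGeom (doubleCarriers C₀)` — while every chart / geometry the tree CONSTRUCTS lives on undoubled carriers (the carriers of
record `B13CarriersCubeChart.cubeChart R` of (w12), the multi-scale chart `NE9MultiScaleChart.msChart` of (w13), the single-scale
`torusChart`).  No tree declaration builds a chart or a geometry on `doubleCarriers C` (grep: the only occurrences of
`CubeChart (doubleCarriers` are the five hypothesis lines above).  Nothing landed is false; the species faces were simply not yet
INSTANTIABLE on any chart of record.  THE REPAIR (this file, XS, kernel): the doubled chart `dblChart Γ` — both copies (X, re) and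
(X, im) of a domain denote the cubes of X — whose constructed geometry, step volumes, localizing families, pins and support map are
those of `Γ` read at the first component, DEFINITIONALLY; the two chart-dependent binders of E5′ (wall-connectedness `hXconn`, the
d-currency comparability `hcmp`) and the cube-currency G1/G2 binders transfer from `Γ` for free.

WHAT IS PROVED (kernel; `[folklore]` bookkeeping, 0 sorry).
§1 `dblChart Γ : CubeChart (doubleCarriers C) α adj D` and the definitional identities `dblChart_cubes/region/vol/clus/pinCube`,
   `dblChart_geom_P/vol/clus/pin/inc`, `dblChart_newTerm` (the localized cluster sum at (X, b) IS the one at X), `dblChart_supp`.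
§2 transfer of the chart binders: `xconn_dbl`, `dcmp_dbl`, `dle_dbl` (any comparison of `C.d` with a function of the cubes), and the
   cube-currency geometry binders `decayExtract_dbl` / `pinBudget_dbl` (= `CubeChart.decayExtract/pinBudget` at `dblChart Γ`, so the
   t-currency species faces' `hdec`/`hpin` are inhabited on `(dblChart Γ).geom` exactly as (w12) inhabits them on `Γ.geom`).
§3 **`torus_termSize_ne9_and_fadingMemory_of_linSizeDischargers_cpieceGain_dbl`** — this lineage's E5′-πG-CL
   (`NE9LinSizeEndCPiece.…_cpieceGain`, p212669) for ANY class-relative piece form `P : CPieceData (doubleCarriers C) …` AT THE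
   DOUBLED CHART `dblChart Γ` of an ordinary torus cube chart `Γ : CubeChart C (Fin ν → ZMod N) (torusAdj ν N) D`, with the two
   chart binders asked OF `Γ` (`hXconn : ∀ X : C.Dom, …(Γ.cubes X)…`, `hcmp : ∀ X : C.Dom, κ·C.d X ≤ a″·d(Γ.cubes X)`) and the
   activity data `μ pre c pt dom` indexed by the cube families of `Γ` — conclusion LITERALLY E5′-πG-CL's.  Species-agnostic: it
   serves `RemData.toC` (ray sub-case) and the owner's `CurData.toC` alike; the species instances are one `exact` away and are left
   to the (w21) twins (owner request l.9603: no new `RemData`-only modules).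
DISGUISE TEST: chart bookkeeping + one END applied BY NAME; one-history sizes; not NE9.

References (TYPE locators only): T. Bałaban, CMP **109** (1987) [Balaban1987RG1] (0.24)–(0.25) p. 257 (domains, d_j), (1.18)
p. 263; CMP **116** (1988) [Balaban1988RG2Cluster] (1.23)–(1.29) pp. 7–8, (2.11)–(2.13) p. 14, (2.27) p. 18, (2.30) p. 18, (2.38)
p. 20, (2.41) p. 21; R. Kotecký, D. Preiss, CMP **103** (1986) [KoteckyPreiss1986].
-/

noncomputable section

namespace Summit.QuantumFields.BalabanUV.T4Continuum.NE9DoubledChart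

open scoped BigOperators
open Metric Set MeasureTheory BoundedContinuousFunction
open Literature.Probability.LatticeModels
open Literature.MathematicalPhysics.QuantumFieldTheory
open Literature.MathematicalPhysics.QuantumFieldTheory.Balaban1983to89
open Literature.MathematicalPhysics.QuantumFieldTheory.Balaban1983to89.T4OutputRate
open Literature.MathematicalPhysics.QuantumFieldTheory.Balaban1983to89.T4ActivityLipschitz
open Literature.MathematicalPhysics.QuantumFieldTheory.Balaban1983to89.T4HistoryLipschitzRecursion
open Literature.MathematicalPhysics.QuantumFieldTheory.Balaban1983to89.T4HistoryLipschitzOuter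
open Literature.MathematicalPhysics.QuantumFieldTheory.Balaban1983to89.T4HistoryLipschitzActivity
open Literature.MathematicalPhysics.QuantumFieldTheory.Balaban1983to89.T4HistoryLipschitzEntropy
open Literature.MathematicalPhysics.QuantumFieldTheory.Balaban1983to89.T4HistoryLipschitzCubeGeometry
open Literature.MathematicalPhysics.QuantumFieldTheory.Balaban1983to89.T4HistoryLipschitzActivity (ClusterGeom)
open Literature.MathematicalPhysics.QuantumFieldTheory.Balaban1983to89.T4HistoryLipschitzSegment
open Literature.MathematicalPhysics.QuantumFieldTheory.Balaban1983to89.T4HistoryLipschitzLinearSize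
open Summit.QuantumFields.BalabanUV.T4Continuum.NE9Lemma1Counting
open Summit.QuantumFields.BalabanUV.T4Continuum.NE9Lemma1Gain
open Summit.QuantumFields.BalabanUV.T4Continuum.NE9Lemma1PieceClass
open Summit.QuantumFields.BalabanUV.T4Continuum.NE9ComplexEncoding (doubleCarriers)
open Summit.QuantumFields.BalabanUV.T4Continuum.NE9LinSizeEnd
open Summit.QuantumFields.BalabanUV.T4Continuum.NE9LinSizeEndCPiece

/-! ## §1 The doubled cube chart and its constructed geometry -/

section Chart

variable {C : Carriers} {α : Type} [DecidableEq α] {adj : α → α → Prop} [DecidableRel adj] {D : ℕ}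

/-- **THE DOUBLED CUBE CHART**: on the Re/Im-doubled carriers (`NE9ComplexEncoding.doubleCarriers`: domains `(X, b)`, `b = true`
the real copy, `b = false` the imaginary copy, same scale and same `d`) both copies of `X` denote the cubes of `X` in the region of
`X`; nonemptiness, the degree bound and the comparability `d ≤ #cubes` are those of `Γ`.
[cite: Balaban1987RG1, (0.24)-(0.25) p.257; Balaban1988RG2Cluster, (2.30) p.18] -/
def dblChart (Γ : CubeChart C α adj D) : CubeChart (doubleCarriers C) α adj D where
  cubes X := Γ.cubes X.1
  region X := Γ.region X.1
  cubes_sub X := Γ.cubes_sub X.1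
  cubes_nonempty X := Γ.cubes_nonempty X.1
  deg := Γ.deg
  d_le X := Γ.d_le X.1

variable (Γ : CubeChart C α adj D)

/-- the cubes of `(X, b)` are the cubes of `X` (definitional). [folklore] -/
@[simp] theorem dblChart_cubes (X : (doubleCarriers C).Dom) : (dblChart Γ).cubes X = Γ.cubes X.1 := rfl

/-- the region of `(X, b)` is the region of `X` (definitional). [folklore] -/
@[simp] theorem dblChart_region (X : (doubleCarriers C).Dom) : (dblChart Γ).region X = Γ.region X.1 := rfl

/-- the step volume of `(X, b)` is the step volume of `X` (definitional). [folklore] -/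
@[simp] theorem dblChart_vol (X : (doubleCarriers C).Dom) : (dblChart Γ).vol X = Γ.vol X.1 := rfl

/-- the localizing families of `(X, b)` are those of `X` (definitional). [folklore] -/
@[simp] theorem dblChart_clus (X : (doubleCarriers C).Dom) : (dblChart Γ).clus X = Γ.clus X.1 := rfl

/-- the pinned cube of `(X, b)` is the pinned cube of `X` (definitional). [folklore] -/
@[simp] theorem dblChart_pinCube (X : (doubleCarriers C).Dom) : (dblChart Γ).pinCube X = Γ.pinCube X.1 := rfl

variable [Std.Symm adj]

/-- the polymers of the doubled geometry are the cube families (definitional). [folklore] -/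
theorem dblChart_geom_P : (dblChart Γ).geom.P = Finset α := rfl

/-- the step volume of the doubled geometry (definitional). [folklore] -/
@[simp] theorem dblChart_geom_vol (X : (doubleCarriers C).Dom) : (dblChart Γ).geom.vol X = Γ.geom.vol X.1 := rfl

/-- the localizing families of the doubled geometry (definitional). [folklore] -/
@[simp] theorem dblChart_geom_clus (X : (doubleCarriers C).Dom) : (dblChart Γ).geom.clus X = Γ.geom.clus X.1 := rfl

/-- the pin of the doubled geometry (definitional). [folklore] -/
@[simp] theorem dblChart_geom_pin (X : (doubleCarriers C).Dom) : (dblChart Γ).geom.pin X = Γ.geom.pin X.1 := rfl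

/-- the incompatibility of the doubled geometry is the cube incompatibility (definitional). [folklore] -/
theorem dblChart_geom_inc (Y Y' : Finset α) : (dblChart Γ).geom.inc Y Y' = Γ.geom.inc Y Y' := rfl

/-- the support map of the doubled chart is the identity, as for `Γ` (definitional). [folklore] -/
@[simp] theorem dblChart_supp (γ : Finset α) : (dblChart Γ).supported.supp γ = Γ.supported.supp γ := rfl

/-- **THE NEW TERM AT A COPY IS THE NEW TERM AT THE DOMAIN**: the localized cluster sum of [II] (2.13) over the localizing families
of `(X, b)` for activities on the cube families IS the one over the localizing families of `X` (definitional — same families, same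
incompatibility). [cite: Balaban1988RG2Cluster, (2.13) p.14] -/
theorem dblChart_newTerm {Bg : Type} {Pot : Type*} (act : ℕ → ℝ → Bg → Pot → Finset α → ℂ) (k : ℕ) (s : ℝ) (U : Bg)
    (X : (doubleCarriers C).Dom) (Q : Pot) :
    (dblChart Γ).geom.newTerm act k s U X Q = Γ.geom.newTerm act k s U X.1 Q := rfl

end Chart

/-! ## §2 Transfer of the chart binders and of the cube-currency geometry binders -/

section Transfer

variable {C : Carriers} {α : Type} [DecidableEq α] {adj : α → α → Prop} [DecidableRel adj] {D : ℕ}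
  (Γ : CubeChart C α adj D)

/-- wall-connectedness of the cubes of every domain transfers to the doubled chart. [folklore] -/
theorem xconn_dbl (h : ∀ X : C.Dom, ∃ b, Polymer.IsConn adj (Γ.cubes X) b) :
    ∀ X : (doubleCarriers C).Dom, ∃ b, Polymer.IsConn adj ((dblChart Γ).cubes X) b := fun X => h X.1

/-- any lower comparison of `κ·d` with a function of the cubes transfers to the doubled chart (E5′'s `hcmp`:
`f Y = a″·linSize Y`). [folklore] -/
theorem dcmp_dbl {κ : ℝ} {f : Finset α → ℝ} (h : ∀ X : C.Dom, κ * C.d X ≤ f (Γ.cubes X)) :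
    ∀ X : (doubleCarriers C).Dom, κ * (doubleCarriers C).d X ≤ f ((dblChart Γ).cubes X) := fun X => h X.1

/-- any upper comparison of `d` with a function of the cubes transfers to the doubled chart (E5′'s [dict] clause `hdle`:
`f Y = linSize Y`). [folklore] -/
theorem dle_dbl {f : Finset α → ℝ} (h : ∀ X : C.Dom, C.d X ≤ f (Γ.cubes X)) :
    ∀ X : (doubleCarriers C).Dom, (doubleCarriers C).d X ≤ f ((dblChart Γ).cubes X) := fun X => h X.1

variable [Std.Symm adj]

/-- G1 in cube currency on the doubled geometry: `CubeChart.decayExtract` at `dblChart Γ`. [cite: Balaban1988RG2Cluster, (2.27) p.18] -/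
theorem decayExtract_dbl {d₁ : ℝ} (hd₁ : 0 ≤ d₁) :
    (dblChart Γ).geom.DecayExtract (fun X => d₁ * ((Γ.cubes X.1).card : ℝ)) ((dblChart Γ).supported.sizeWeight d₁) :=
  (dblChart Γ).decayExtract hd₁

/-- G2 in cube currency on the doubled geometry: `CubeChart.pinBudget` at `dblChart Γ`. [cite: Balaban1988RG2Cluster, (2.40)-(2.41) p.21] -/
theorem pinBudget_dbl {a₁ d₁ κ : ℝ} (ha₁ : 0 ≤ a₁) (hκ : 0 ≤ κ) (hκd : κ ≤ d₁) :
    (dblChart Γ).geom.PinBudget ((dblChart Γ).supported.sizeWeight a₁) (fun X => d₁ * ((Γ.cubes X.1).card : ℝ))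
      (fun _ => a₁) κ :=
  (dblChart Γ).pinBudget ha₁ hκ hκd

end Transfer

/-! ## §3 E5′-πG-CL at the doubled chart of an ordinary torus cube chart (species-agnostic) -/

section EndFace

variable {ν N : ℕ} {C : Carriers} {D : ℕ}
variable {Bg : Type} {Sp : Type*} [TopologicalSpace Sp] [MeasurableSpace Sp]
  [OpensMeasurableSpace Sp] {F : Type*} [Fintype F] {Ω : Type*} [MeasurableSpace Ω]

/-- **E5′-πG-CL AT THE DOUBLED CHART (kernel composition BY NAME).**  This lineage's `NE9LinSizeEndCPiece.
torus_termSize_ne9_and_fadingMemory_of_linSizeDischargers_cpieceGain` (p212669) for a class-relative piece form `P` on the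
DOUBLED carriers (every FORM-level species of the (1.23)-pieces is one: `RemData.toC`, `CurData.toC`) at the chart
`Γ' := dblChart Γ` of an ORDINARY torus cube chart `Γ` of the carriers `C`: the activity data `μ pre c pt dom` are indexed by the
cube families of `Γ`, the new term at a copy `(X, b)` is the localized cluster sum over the localizing families of `X`
(`dblChart_newTerm`), and the two chart binders are asked of `Γ` ITSELF — `hXconn` (wall-connected cubes, [I] p. 257) and the
d-currency comparability `hcmp : κ·C.d X ≤ a″·d(Γ.cubes X)` ([II] (2.30) p. 18 TYPE).  Every other binder and the conclusion
LITERALLY E5′-πG-CL's (rate letter `μ = ω + 4·lipbar·(a₁·e^{−a″(ν+1)})·c_Q`).  NOT claimed: that any chart of record carries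
Bałaban's 𝐃_k (O-NE9-1). [cite: Balaban1987RG1, p.257, (1.18) p.263; Balaban1988RG2Cluster, (1.23)-(1.29) pp.7-8, (2.13) p.14, (2.27) p.18, (2.30) p.18, (2.38) p.20, (2.41) p.21; KoteckyPreiss1986, (1)-(3)] -/
theorem torus_termSize_ne9_and_fadingMemory_of_linSizeDischargers_cpieceGain_dbl
    (Γ : CubeChart C (Fin ν → ZMod N) (torusAdj ν N) D) {ι αi βi γi : Type} (P : CPieceData (doubleCarriers C) Bg ι αi βi γi)
    {E : Functional (doubleCarriers C) Bg} {W : Set (ℕ → ℝ)} {Adm : Set (Bg → (doubleCarriers C).Dom → ℝ)}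
    {Ψ : ℕ → ℝ → (ι → ℝ) → Bg → (doubleCarriers C).Dom → ℝ}
    {μ : ℕ → ℝ → Bg → Finset (Fin ν → ZMod N) → Measure Ω} {pre : ℕ → ℝ → Bg → Finset (Fin ν → ZMod N) → Ω → ℂ}
    {c : ℕ → ℝ → Bg → Finset (Fin ν → ZMod N) → Ω → F → ℂ}
    {pt : ℕ → ℝ → Bg → Finset (Fin ν → ZMod N) → Ω → F → Sp} {β : ℕ → Sp → ℝ}
    {dom : ℕ → Finset (Fin ν → ZMod N) → F → Finset (Fin ν → ZMod N)}
    {lip ε' α4 : ℕ → ℝ} {a₁ a'' κ κ₁ d0 O1 cQ ω lipbar ℓ a a' : ℝ} {Kp : ℕ → ι → ℝ} {gain : ℕ → ℕ → ℝ}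
    {lam p₀ Nsz : ℕ → ℝ}
    (ρ : ℕ → (ι → ℝ) → (Sp →ᵇ ℂ))
    (h0 : ScaleZeroFree E W) (hAdm : AdmissibleTerms E W Adm) (hres : AdmRestrict Adm)
    -- the class-relative piece form on the doubled carriers: structure binders, ONE per-piece bound ON THE CLASS, the counts
    (h0P : PieceZero P) (hloc : PieceLocal P) (hsrc : CSrcScale P) (hA : PieceAdditiveOn Adm P)
    (hPiece : PieceBoundOnG Adm P κ κ₁ d0 Kp gain) (hLev : LevelCountsG P.frame κ κ₁ O1 cQ gain (agePow ω))
    (hKp : ∀ k y, 0 ≤ Kp k y) (hO1 : 0 ≤ O1) (hgain : ∀ k j, 0 ≤ gain k j) (hcQ : 0 ≤ cQ) (hω : 0 < ω)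
    -- E5′'s recursion-side binders at `T := cpieceChannel P`; the new term at a copy = the cluster sum at the domain (`Γ.geom`)
    (hfac : Factorises E W (cpieceChannel P) Ψ) (hlast : LastCouplingLipschitz E W (cpieceChannel P) Ψ κ lam)
    (hρ : ∀ (k : ℕ) (Q Q' : ι → ℝ) (M : ℝ), (∀ y, |Q y - Q' y| ≤ weightOf P.frame κ₁ d0 O1 Kp k y * M) →
      ‖ρ k Q - ρ k Q'‖ ≤ M)
    (hΨ : ∀ (k : ℕ) (s : ℝ) (Q Q' : ι → ℝ) (U : Bg) (X : (doubleCarriers C).Dom),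
      Ψ k s Q U X - Ψ k s Q' U X =
        (Γ.geom.newTerm (Γ.geom.avgExpLinearAct μ pre fun k s U γ ω => evalFunctional (c k s U γ ω) (pt k s U γ ω))
            k s U X.1 (ρ k Q) -
          Γ.geom.newTerm (Γ.geom.avgExpLinearAct μ pre fun k s U γ ω => evalFunctional (c k s U γ ω) (pt k s U γ ω))
            k s U X.1 (ρ k Q')).re)
    (hexpl : ∀ g ∈ W, ∀ (k : ℕ) (Q : ι → ℝ) (U : Bg) (X : (doubleCarriers C).Dom), (doubleCarriers C).scale X = k + 1 →
      |Ψ k (g k) Q U X -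
          (Γ.geom.newTerm (Γ.geom.avgExpLinearAct μ pre fun k s U γ ω => evalFunctional (c k s U γ ω) (pt k s U γ ω))
            k (g k) U X.1 (ρ k Q)).re| ≤ Real.exp (-(κ * (doubleCarriers C).d X)) * p₀ k)
    (hbase : ∀ g ∈ W, ∀ (U : Bg) (X : (doubleCarriers C).Dom), (doubleCarriers C).scale X = 0 →
      |E g U X| ≤ Real.exp (-(κ * (doubleCarriers C).d X)) * Nsz 0)
    (hNsucc : ∀ j, p₀ j + a₁ * Real.exp (-(a'' * (ν + 1))) ≤ Nsz (j + 1)) (hNnn : ∀ j, 0 ≤ Nsz j)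
    (hbox : ∀ (k : ℕ) (Q : ι → ℝ),
      (∀ y, |Q y| ≤ weightOf P.frame κ₁ d0 O1 Kp k y * sizeRadius (tauOfG cQ (agePow ω)) Nsz k) → ∀ x, ‖ρ k Q x‖ ≤ β k x)
    -- activity side on the cube families of `Γ` (verbatim E5′)
    (hpre : ∀ k s U γ, AEStronglyMeasurable (pre k s U γ) (μ k s U γ))
    (hc : ∀ k s U γ Y, AEStronglyMeasurable (fun ω => c k s U γ ω Y) (μ k s U γ))
    (hpt : ∀ k s U γ Y, Measurable fun ω => pt k s U γ ω Y) (hlip : ∀ k, 0 < lip k) (hlipb : ∀ k, lip k ≤ lipbar)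
    (hint₀ : ∀ k s U γ, Integrable (fun ω => ‖pre k s U γ ω‖ * Real.exp (boxExponent c pt β k s U γ ω)) (μ k s U γ))
    (hmeet : ∀ k s U (γ : Finset (Fin ν → ZMod N)) ω Y, c k s U γ ω Y ≠ 0 → ∃ x ∈ γ, x ∈ dom k γ Y)
    (hα4 : ∀ k, 0 ≤ α4 k) (ha : (2:ℝ) ^ ν * Real.log 2 + Real.log (8 * ν) ≤ a)
    (hliplb : ∀ k, α4 k * 2 ^ (ν + 1 + 2 ^ ν) ≤ lip k)
    (hlin : ∀ k s U (γ : Finset (Fin ν → ZMod N)) ω Y,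
      ‖c k s U γ ω Y‖ ≤ α4 k * Real.exp (-(a * (linSize (dom k γ Y) : ℝ))))
    (hdomconn : ∀ k (γ : Finset (Fin ν → ZMod N)) Y, (dom k γ Y).Nonempty →
      ∃ b ∈ dom k γ Y, Polymer.IsConn (torusAdj ν N) (dom k γ Y) b)
    (hdominj : ∀ k (γ : Finset (Fin ν → ZMod N)), Set.InjOn (dom k γ) {Y | (dom k γ Y).Nonempty})
    -- THE TWO CHART BINDERS, ASKED OF THE ORDINARY CHART `Γ`
    (hXconn : ∀ X : C.Dom, ∃ b, Polymer.IsConn (torusAdj ν N) (Γ.cubes X) b)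
    (hcmp : ∀ X : C.Dom, κ * C.d X ≤ a'' * (linSize (Γ.cubes X) : ℝ))
    (hε' : ∀ k, 0 ≤ ε' k)
    (hdecayLin : ∀ g ∈ W, ∀ (k : ℕ) (U : Bg) (X : (doubleCarriers C).Dom), (doubleCarriers C).scale X = k + 1 →
      ∀ γ' ∈ Γ.vol X.1,
      ∫ ω, ‖pre k (g k) U γ' ω‖ * Real.exp (boxExponent c pt β k (g k) U γ' ω) ∂(μ k (g k) U γ') ≤
        ε' k * Real.exp (-(a' * (linSize γ' : ℝ))))
    (ha₁ : 0 ≤ a₁) (ha'' : 0 ≤ a'')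
    (hrate : (2:ℝ) ^ ν * Real.log 2 + Real.log (8 * ν) ≤ a' - a'' - 2 ^ ν * (a₁ + Real.log 2))
    (hsmall : ∀ k, ((D : ℝ) + 1) * (2 * ε' k) * Real.exp (a'' * (ν + 1) + 2 ^ ν * (a₁ + Real.log 2)) *
      2 ^ (ν + 1 + 2 ^ ν) ≤ a₁)
    (hℓ : 0 ≤ ℓ) (hlam : ∀ k, lam k ≤ ℓ) :
    TermSize E W κ Nsz ∧
      NE9 E W κ (prodModuli ℓ fun _ => ω + 4 * lipbar * (a₁ * Real.exp (-(a'' * (ν + 1)))) * cQ) ∧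
        FadingMemory (ℓ / (ω + 4 * lipbar * (a₁ * Real.exp (-(a'' * (ν + 1)))) * cQ))
          (ω + 4 * lipbar * (a₁ * Real.exp (-(a'' * (ν + 1)))) * cQ)
          (prodModuli ℓ fun _ => ω + 4 * lipbar * (a₁ * Real.exp (-(a'' * (ν + 1)))) * cQ) :=
  torus_termSize_ne9_and_fadingMemory_of_linSizeDischargers_cpieceGain (dblChart Γ) P ρ h0 hAdm hres h0P hloc hsrc hA hPiece
    hLev hKp hO1 hgain hcQ hω hfac hlast hρ hΨ hexpl hbase hNsucc hNnn hbox hpre hc hpt hlip hlipb hint₀ hmeet hα4 ha hliplb hlin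
    hdomconn hdominj (xconn_dbl Γ hXconn) (dcmp_dbl Γ (f := fun Y => a'' * (linSize Y : ℝ)) hcmp) hε' hdecayLin ha₁ ha'' hrate hsmall hℓ hlam

end EndFace

end Summit.QuantumFields.BalabanUV.T4Continuum.NE9DoubledChart

end
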